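import Summits.QuantumFields.YangMills.Theorems.BalabanUVNodesN12AtRecord11CB10YZW
import Literature.MathematicalPhysics.QuantumFieldTheory.Balaban1983to89.B15RPrime1100AtRecord
import Literature.MathematicalPhysics.QuantumFieldTheory.Balaban1983to89.B15Claim189PinAtRecord

/-!
# BalabanUVNodes ∕ N12 AT THE STAGE-11 W-PINNED RECORD WITH THE (1.100) DATA PINNED — `S_N12 Rec` for every `Rec ⊆ Node00.IsRecordOfRecord₁₁CB10YZW(B8)` from the
# record's own `rstep` proviso, positive mass, and EXACTLY [Balaban1989LargeFieldI] Proposition 1 (1.78), (1.80), (1.89) at the residual letters of the presenting packages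
# whose 𝐑′-data IS the 𝐑-step's (1.100)-reading (`Node00.ResidW.pinRPrime`, the n12-e seat's `B15RPrime1100OfRep` ∕ `…AtRecord`): the (1.102) display RETIRED
# (Track A, DAG node N12 = [B15, Balaban1989LargeFieldI] CMP 122 (1989) 175, (0.1)–(0.6) p.176, Prop. 1 p.194, (1.80), (1.89), (1.99)–(1.102); cluster K1 `StabilityBAtRecordR11e`;
# seat `pub-ymgap-dag-n12-e` (R134 fan-out, strategy s3 = alternative currency «𝐑′ (1.99)–(1.100) p.201 chain»), 2026-08-26; count-neutral)

HONEST FRAMING.  Count-neutral kernel BOOKKEEPING BY NAME over LANDED modules: the N12 s2 seat's `BalabanUVNodesN12AtRecord11CB10YZW` (p450999: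
`s_N12_of_refines₁₁CB10YZW_of_displays`, `…B8_of_displays`, `b15_main_of_up_view₁₁B10YZW_of_displays`), node00-def g30 ∕ g31's `Node00.CarriersW` ∕ `Record11Carriers(B8)`
(`WDisplays₁₀`, `IsRecordOfRecord₁₁CB10YZW(B8)`), and this seat's Literature modules `B15RPrime1100OfRep` (p451546: the (1.100)-datum `rPrimeDataOfSel` OF the 𝐑-step, with
`rPrime1100 (rPrimeDataOfSel r sel fib) = RopReal (rterm r) sel fib`) and `B15RPrime1100AtRecord` (p452570: `ResidW.pinRPrime`, `wDisplays₁₀_of_rPrimePin` — at a layer whose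
`D1100 P` IS the 𝐑-step's reading and `kSel P < P.K`, `WDisplays₁₀` follows from def-T's `Provisos₁₀.rstep` + positive mass + Prop. 1 + (1.80) + (1.89)).  NOT A DISCHARGE OF N12:
every closer takes AS HYPOTHESES, keyed to the packages presenting the record, positive mass of the pre-𝐑 terms (chair R446 (A) MASS reading), the pin equation on the hidden
layer's `D1100` with `kSel P < P.K` (satisfiable — `pinRPrime` — but NOT derivable from the record predicate, whose residual layer is free data: NODE 00's act to make it
definitional), and [Balaban1989LargeFieldI]'s Proposition 1 (1.78) on `λ.LF P`, (1.80) and (1.89) on `λ.D189 P` — TYPED, NOT ASSERTED.  What is NEW relative to p450999: the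
fourth printed display, (1.102) for `λ.D1100 P`, is no longer a hypothesis — it is the theorem `normalization1102_trhoOfRecord9_of_provisos₁₀` at the pinned data.  Nothing of
Bałaban's asserted; one finite four-torus programme at fixed `ε`; nothing continuum ∕ ℝ⁴ ∕ infinite volume ∕ OS ∕ mass gap ∕ Clay.  0 `sorry`, 0 `def`, 0 `instance`, standard axioms.
Filed `--supports` K1 `StabilityBAtRecordR11e` (stmt-QuantumFields-19674).

WHAT THIS FILE PROVES.
* §1 `b15_main_of_up_view₁₁B10YZW_of_rPrimePin` — pointed: a world bound at run `P` over the four-pin Stage-11 view satisfies `Dag.B15_main` at `P` from `Provisos₁₁`,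
  `kSel P < P.K`, the pin equation, mass, Prop. 1, (1.80), (1.89); `b15_main_of_up_view₁₁B10YZW_pinRPrime` — the same AT a pinned layer (pin by `rfl`).
* §2 **`s_N12_of_refines₁₁CB10YZW_of_rPrimePin`**, **`s_N12_of_refines₁₁CB10YZWB8_of_rPrimePin`** — `S_N12 Rec` for every `Rec` refining the four-∕five-pin Stage-11 record, from the
  reduced displays keyed to the presenting packages (p450999's `_of_displays` closers ∘ `wDisplays₁₀_of_rPrimePin`).
Sources: [Balaban1989LargeFieldI] (0.2)–(0.6) p.176, Prop. 1 (1.78) p.194, (1.80) p.195, (1.89) p.198, (1.99)–(1.102) pp.200–201; record dictionaries [Balaban1988Convergent]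
(2.18) p.257, (3.25) p.270, [Balaban1989LargeFieldII] Thm 1 + (0.1) pp.355–356.
-/

noncomputable section

open MeasureTheory

namespace Summit.QuantumFields.YangMills.BalabanUVNodes.N12RPrimePin

open Literature.MathematicalPhysics.QuantumFieldTheory.Balaban1983to89
open Literature.MathematicalPhysics.QuantumFieldTheory.Balaban1983to89.T4Continuum (T4Family FiniteEpsData)
open Literature.MathematicalPhysics.QuantumFieldTheory.Balaban1983to89.DagBinding (WorldP leavesP B15Leaf)
open Literature.MathematicalPhysics.QuantumFieldTheory.Balaban1983to89.Node00
open Literature.MathematicalPhysics.QuantumFieldTheory.Balaban1983to89.B15 (Prop1Printed Ineq180)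
open Literature.MathematicalPhysics.QuantumFieldTheory.Balaban1983to89.B15.BasicStep (Claim189)
open Literature.MathematicalPhysics.QuantumFieldTheory.Balaban1983to89.B15Claim189Assembly (new189 chiPP dom)
open Literature.MathematicalPhysics.QuantumFieldTheory.Balaban1983to89.B8Eq17ClassAkV1 (plaqsOf)
open Literature.MathematicalPhysics.QuantumFieldTheory.Balaban1983to89.B15RPrime1100OfRep (rPrimeDataOfSel)
open Literature.MathematicalPhysics.QuantumFieldTheory.Balaban1983to89.B15RPrime1100AtRecord (wDisplays₁₀_of_rPrimePin wDisplays₁₀_pinRPrime_of)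
open YMDAG.UVSplit (RecordPred Datum S_N12)
open Summit.QuantumFields.YangMills.BalabanUVNodes.N12AtRecord11CB10YZW
  (b15_main_of_up_view₁₁B10YZW_of_displays s_N12_of_refines₁₁CB10YZW_of_displays s_N12_of_refines₁₁CB10YZWB8_of_displays)

variable {N : ℕ} [NeZero N]

/-! ## §1 POINTED — a world bound over the four-pin Stage-11 view, (1.100) data pinned -/

section Pointed

variable {F : T4Family} {w : WorldP}

/-- **POINTED CLOSER, (1.100) DATA PINNED**: a world bound at run `P` over the four-pin Stage-11 view `θ.view₁₁B10YZW Mstar ops ζ λ` satisfies `Dag.B15_main` at `P` as soon as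
`θ.Provisos₁₁`, `λ.kSel P < P.K`, `λ.D1100 P` IS the 𝐑-step's (1.100)-reading, the pre-𝐑 terms have positive mass, and [IV] Proposition 1 (1.78), (1.80), (1.89) hold at
`(λ.LF P, λ.D189 P)` — p450999's `b15_main_of_up_view₁₁B10YZW_of_displays` ∘ `wDisplays₁₀_of_rPrimePin`; in-edges unused.
[cite: Balaban1989LargeFieldI, Prop. 1 (1.78) p.194, (0.2)–(0.6) p.176, (1.80) p.195, (1.89) p.198, (1.99)–(1.102) pp.200–201] -/
theorem b15_main_of_up_view₁₁B10YZW_of_rPrimePin (θ : Stage11Params F N) (hP : θ.Provisos₁₁) (Mstar : ℕ) (ops : OpsY N θ.toStage3Params Mstar) (ζ : ResidZ F N)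
    (lamW : ResidW F N) {P : B12.RunParams} (hup : w.up P = upOfRecord₅C F N (θ.view₁₁B10YZW F N Mstar ops ζ lamW) P) (hk : lamW.kSel P < P.K)
    (hpin : lamW.D1100 P
      = rPrimeDataOfSel (repTOfRecord9 F N θ.ν θ.τ9 (EOfRecord₁₀ F N θ.toStage9Params) (wOfRecord₉ F N θ.toStage9Params) θ.ppSel P
            (gOfRecord₁₀ F N θ.toStage9Params P) (lamW.kSel P))
          (θ.ppSel P (gOfRecord₁₀ F N θ.toStage9Params P) (lamW.kSel P + 1)) (fibOfSeq F θ.ν θ.τ9 P (gOfRecord₁₀ F N θ.toStage9Params P) (lamW.kSel P + 1)))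
    (hmass : ∀ s, 0 < ∫ V, rterm (repTOfRecord9 F N θ.ν θ.τ9 (EOfRecord₁₀ F N θ.toStage9Params) (wOfRecord₉ F N θ.toStage9Params) θ.ppSel P
      (gOfRecord₁₀ F N θ.toStage9Params P) (lamW.kSel P)) s V ∂(fieldMeasure (F.P P.K) (lamW.kSel P + 1) (SU N)))
    (hP1 : Prop1Printed (lamW.LF P))
    (h180 : ∀ U, new189 (lamW.D189 P) U → ∀ i, (lamW.D189 P).h ≤ i → i ≤ (lamW.D189 P).k → ∀ q ∈ plaqsOf (dom (lamW.D189 P) i),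
      Ineq180 ((lamW.D189 P).dev0 U q) ((lamW.D189 P).ε (lamW.D189 P).k) (lamW.D189 P).η (lamW.D189 P).B₃ (lamW.D189 P).B₅ (lamW.D189 P).M (lamW.D189 P).δ
        ((lamW.D189 P).dist q) (lamW.D189 P).O1)
    (h189 : Claim189 (new189 (lamW.D189 P)) (chiPP (lamW.D189 P))) : Dag.B15_main (leavesP w P) :=
  b15_main_of_up_view₁₁B10YZW_of_displays θ Mstar ops ζ lamW hup (wDisplays₁₀_of_rPrimePin hP.base hk hpin hmass hP1 h180 h189)

/-- **The same AT A PINNED LAYER `λ.pinRPrime θ.toStage9Params`** (pin equation by `rfl`): `Provisos₁₁` + `kSel P < P.K` + positive mass + Prop. 1 + (1.80) + (1.89) ⇒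
`Dag.B15_main` at `P`. [cite: Balaban1989LargeFieldI, Prop. 1 (1.78) p.194, (0.2)–(0.6) p.176, (1.80) p.195, (1.89) p.198, (1.99)–(1.102) pp.200–201] -/
theorem b15_main_of_up_view₁₁B10YZW_pinRPrime (θ : Stage11Params F N) (hP : θ.Provisos₁₁) (Mstar : ℕ) (ops : OpsY N θ.toStage3Params Mstar) (ζ : ResidZ F N)
    (lamW : ResidW F N) {P : B12.RunParams}
    (hup : w.up P = upOfRecord₅C F N (θ.view₁₁B10YZW F N Mstar ops ζ (lamW.pinRPrime θ.toStage9Params)) P) (hk : lamW.kSel P < P.K)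
    (hmass : ∀ s, 0 < ∫ V, rterm (repTOfRecord9 F N θ.ν θ.τ9 (EOfRecord₁₀ F N θ.toStage9Params) (wOfRecord₉ F N θ.toStage9Params) θ.ppSel P
      (gOfRecord₁₀ F N θ.toStage9Params P) (lamW.kSel P)) s V ∂(fieldMeasure (F.P P.K) (lamW.kSel P + 1) (SU N)))
    (hP1 : Prop1Printed (lamW.LF P))
    (h180 : ∀ U, new189 (lamW.D189 P) U → ∀ i, (lamW.D189 P).h ≤ i → i ≤ (lamW.D189 P).k → ∀ q ∈ plaqsOf (dom (lamW.D189 P) i),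
      Ineq180 ((lamW.D189 P).dev0 U q) ((lamW.D189 P).ε (lamW.D189 P).k) (lamW.D189 P).η (lamW.D189 P).B₃ (lamW.D189 P).B₅ (lamW.D189 P).M (lamW.D189 P).δ
        ((lamW.D189 P).dist q) (lamW.D189 P).O1)
    (h189 : Claim189 (new189 (lamW.D189 P)) (chiPP (lamW.D189 P))) : Dag.B15_main (leavesP w P) :=
  b15_main_of_up_view₁₁B10YZW_of_displays θ Mstar ops ζ (lamW.pinRPrime θ.toStage9Params) hup
    (wDisplays₁₀_pinRPrime_of hP.base hk hmass hP1 h180 h189)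

end Pointed

/-! ## §2 `S_N12 Rec` for every record predicate refining the Stage-11 W-pinned record, (1.100) data pinned at the presenting packages -/

/-- **`S_N12 Rec` FOR EVERY `Rec ⊆ ₁₁CB10YZW`, (1.100) DATA PINNED** — per `Rec`-pair and presenting package and run: `kSel P < P.K`, the hidden layer's `D1100 P` IS the 𝐑-step's
(1.100)-reading, positive mass, [IV] Proposition 1 (1.78), (1.80) on the ℍ-domains, (1.89) ⇒ `S_N12 Rec` (in-edges unused; p450999's `s_N12_of_refines₁₁CB10YZW_of_displays` ∘
`wDisplays₁₀_of_rPrimePin`).  NOT-A-DISCHARGE until the three estimates are inhabited at objects of record and NODE 00 makes the pin definitional.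
[cite: Balaban1989LargeFieldI, Prop. 1 (1.78) p.194, (0.2)–(0.6) p.176, (1.80) p.195, (1.89) p.198, (1.99)–(1.102) pp.200–201] -/
theorem s_N12_of_refines₁₁CB10YZW_of_rPrimePin (Rec : RecordPred N)
    (href : ∀ (F : T4Family) (D : Datum F N) (w : WorldP), Rec F D w → IsRecordOfRecord₁₁CB10YZW F N D w)
    (hyp : ∀ (F : T4Family) (D : Datum F N) (w : WorldP), Rec F D w →
      ∀ (θ : Stage11Params F N) (hP : θ.Provisos₁₁) (Mstar : ℕ) (ops : OpsY N θ.toStage3Params Mstar) (ζ : ResidZ F N) (lamW : ResidW F N),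
        θ.Admissible → D = datumOfRecord₁₁ F N θ hP → (∀ P, w.up P = upOfRecord₅C F N (θ.view₁₁B10YZW F N Mstar ops ζ lamW) P) → ∀ P : B12.RunParams,
          lamW.kSel P < P.K ∧
          lamW.D1100 P
            = rPrimeDataOfSel (repTOfRecord9 F N θ.ν θ.τ9 (EOfRecord₁₀ F N θ.toStage9Params) (wOfRecord₉ F N θ.toStage9Params) θ.ppSel P
                  (gOfRecord₁₀ F N θ.toStage9Params P) (lamW.kSel P))
                (θ.ppSel P (gOfRecord₁₀ F N θ.toStage9Params P) (lamW.kSel P + 1))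
                (fibOfSeq F θ.ν θ.τ9 P (gOfRecord₁₀ F N θ.toStage9Params P) (lamW.kSel P + 1)) ∧
          (∀ s, 0 < ∫ V, rterm (repTOfRecord9 F N θ.ν θ.τ9 (EOfRecord₁₀ F N θ.toStage9Params) (wOfRecord₉ F N θ.toStage9Params) θ.ppSel P
            (gOfRecord₁₀ F N θ.toStage9Params P) (lamW.kSel P)) s V ∂(fieldMeasure (F.P P.K) (lamW.kSel P + 1) (SU N))) ∧
          Prop1Printed (lamW.LF P) ∧
          (∀ U, new189 (lamW.D189 P) U → ∀ i, (lamW.D189 P).h ≤ i → i ≤ (lamW.D189 P).k → ∀ q ∈ plaqsOf (dom (lamW.D189 P) i),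
            Ineq180 ((lamW.D189 P).dev0 U q) ((lamW.D189 P).ε (lamW.D189 P).k) (lamW.D189 P).η (lamW.D189 P).B₃ (lamW.D189 P).B₅ (lamW.D189 P).M
              (lamW.D189 P).δ ((lamW.D189 P).dist q) (lamW.D189 P).O1) ∧
          Claim189 (new189 (lamW.D189 P)) (chiPP (lamW.D189 P))) :
    S_N12 Rec :=
  s_N12_of_refines₁₁CB10YZW_of_displays Rec href (fun F D w hR θ hP Mstar ops ζ lamW hθ hD hup P => by
    obtain ⟨hk, hpin, hmass, hP1, h180, h189⟩ := hyp F D w hR θ hP Mstar ops ζ lamW hθ hD hup P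
    exact wDisplays₁₀_of_rPrimePin hP.base hk hpin hmass hP1 h180 h189)

/-- **The same at the five-pin record predicate `…₁₁CB10YZWB8`** (S-binding; p450999's `s_N12_of_refines₁₁CB10YZWB8_of_displays`).
[cite: Balaban1989LargeFieldI, Prop. 1 (1.78) p.194, (0.2)–(0.6) p.176, (1.80) p.195, (1.89) p.198, (1.99)–(1.102) pp.200–201] -/
theorem s_N12_of_refines₁₁CB10YZWB8_of_rPrimePin (Rec : RecordPred N)
    (href : ∀ (F : T4Family) (D : Datum F N) (w : WorldP), Rec F D w → IsRecordOfRecord₁₁CB10YZWB8 F N D w)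
    (hyp : ∀ (F : T4Family) (D : Datum F N) (w : WorldP), Rec F D w →
      ∀ (θ : Stage11Params F N) (hP : θ.Provisos₁₁) (lam : ResidB8 θ.toStage3Params) (Mstar : ℕ) (ops : OpsY N θ.toStage3Params Mstar) (ζ : ResidZ F N)
        (lamW : ResidW F N), θ.Admissible → D = datumOfRecord₁₁ F N θ hP →
          (∀ P, w.up P = upOfRecord₅CS F N (θ.view₁₁B8B10YZW F N lam Mstar ops ζ lamW) P) → ∀ P : B12.RunParams,
          lamW.kSel P < P.K ∧
          lamW.D1100 P
            = rPrimeDataOfSel (repTOfRecord9 F N θ.ν θ.τ9 (EOfRecord₁₀ F N θ.toStage9Params) (wOfRecord₉ F N θ.toStage9Params) θ.ppSel P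
                  (gOfRecord₁₀ F N θ.toStage9Params P) (lamW.kSel P))
                (θ.ppSel P (gOfRecord₁₀ F N θ.toStage9Params P) (lamW.kSel P + 1))
                (fibOfSeq F θ.ν θ.τ9 P (gOfRecord₁₀ F N θ.toStage9Params P) (lamW.kSel P + 1)) ∧
          (∀ s, 0 < ∫ V, rterm (repTOfRecord9 F N θ.ν θ.τ9 (EOfRecord₁₀ F N θ.toStage9Params) (wOfRecord₉ F N θ.toStage9Params) θ.ppSel P
            (gOfRecord₁₀ F N θ.toStage9Params P) (lamW.kSel P)) s V ∂(fieldMeasure (F.P P.K) (lamW.kSel P + 1) (SU N))) ∧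
          Prop1Printed (lamW.LF P) ∧
          (∀ U, new189 (lamW.D189 P) U → ∀ i, (lamW.D189 P).h ≤ i → i ≤ (lamW.D189 P).k → ∀ q ∈ plaqsOf (dom (lamW.D189 P) i),
            Ineq180 ((lamW.D189 P).dev0 U q) ((lamW.D189 P).ε (lamW.D189 P).k) (lamW.D189 P).η (lamW.D189 P).B₃ (lamW.D189 P).B₅ (lamW.D189 P).M
              (lamW.D189 P).δ ((lamW.D189 P).dist q) (lamW.D189 P).O1) ∧
          Claim189 (new189 (lamW.D189 P)) (chiPP (lamW.D189 P))) :
    S_N12 Rec :=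
  s_N12_of_refines₁₁CB10YZWB8_of_displays Rec href (fun F D w hR θ hP lam Mstar ops ζ lamW hθ hD hup P => by
    obtain ⟨hk, hpin, hmass, hP1, h180, h189⟩ := hyp F D w hR θ hP lam Mstar ops ζ lamW hθ hD hup P
    exact wDisplays₁₀_of_rPrimePin hP.base hk hpin hmass hP1 h180 h189)

/-! ## §3 (v1.1) `S_N12 Rec` when the presenting packages' residual [IV] layers ARE doubly pinned layers (the n12-e seat's `ResidW.pinD189` ∘ `ResidW.pinRPrime`) -/

section PinnedLayers

open Literature.MathematicalPhysics.QuantumFieldTheory.Balaban1983to89.B15Claim189PinAtRecord (D189OfRecord wDisplays₁₀_pinD189_of_rPrimePin)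
open Literature.MathematicalPhysics.QuantumFieldTheory.Balaban1983to89.Node00 (Sit189)

/-- **`S_N12 Rec` FOR EVERY `Rec ⊆ ₁₁CB10YZW` WHOSE PRESENTING PACKAGES READ DOUBLY PINNED LAYERS** (v1.1): per `Rec`-pair, presenting package and run, the hidden residual
[IV] layer IS `(λ₀.pinD189 θ σ).pinRPrime θ` for some base layer `λ₀` and situation family `σ` (an equation of layers — what a NODE 00 record ranging `lamW` over pinned
layers delivers by `rfl`), the step is below the torus exponent, the pre-𝐑 terms have positive mass, and [IV] Proposition 1 (1.78) on `λ₀.LF P`, (1.80) on the ℍ-domains at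
the letter `σ.dev0`, (1.89) at the PINNED letters `D189OfRecord θ P (σ P)` (its remaining functions and dropped `χ″_k` r11's CONCRETE functions of def-R's background —
`B15Claim189PinAtRecord.new189_D189OfRecord_iff ∕ chiPP_D189OfRecord_iff`) ⇒ `S_N12 Rec`; (0.4), (0.6), (1.102) theorems.  NOT-A-DISCHARGE.
[cite: Balaban1989LargeFieldI, Prop. 1 (1.78) p.194, (0.2)–(0.6) p.176, (1.80) p.195, (1.89) p.198, (1.99)–(1.102) pp.200–201] -/
theorem s_N12_of_refines₁₁CB10YZW_of_pinnedLayers (Rec : RecordPred N)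
    (href : ∀ (F : T4Family) (D : Datum F N) (w : WorldP), Rec F D w → IsRecordOfRecord₁₁CB10YZW F N D w)
    (hyp : ∀ (F : T4Family) (D : Datum F N) (w : WorldP), Rec F D w →
      ∀ (θ : Stage11Params F N) (hP : θ.Provisos₁₁) (Mstar : ℕ) (ops : OpsY N θ.toStage3Params Mstar) (ζ : ResidZ F N) (lamW : ResidW F N),
        θ.Admissible → D = datumOfRecord₁₁ F N θ hP → (∀ P, w.up P = upOfRecord₅C F N (θ.view₁₁B10YZW F N Mstar ops ζ lamW) P) →
          ∃ (lam₀ : ResidW F N) (σ : ∀ P : B12.RunParams, Sit189 F N P.K),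
            lamW = (lam₀.pinD189 θ.toStage9Params σ).pinRPrime θ.toStage9Params ∧ ∀ P : B12.RunParams,
              lam₀.kSel P < P.K ∧
              (∀ s, 0 < ∫ V, rterm (repTOfRecord9 F N θ.ν θ.τ9 (EOfRecord₁₀ F N θ.toStage9Params) (wOfRecord₉ F N θ.toStage9Params) θ.ppSel P
                (gOfRecord₁₀ F N θ.toStage9Params P) (lam₀.kSel P)) s V ∂(fieldMeasure (F.P P.K) (lam₀.kSel P + 1) (SU N))) ∧
              Prop1Printed (lam₀.LF P) ∧
              (∀ U, new189 (D189OfRecord θ.toStage9Params P (σ P)) U → ∀ i, (σ P).h ≤ i → i ≤ (σ P).k →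
                ∀ q ∈ plaqsOf (dom (D189OfRecord θ.toStage9Params P (σ P)) i),
                  Ineq180 ((σ P).dev0 U.1 q) (epsOfRecord θ.ν (gOfRecord₁₀ F N θ.toStage9Params P) (σ P).k) ((F.P P.K).eta (σ P).k) (σ P).B₃ (σ P).B₅ (σ P).M
                    (σ P).δ ((σ P).dist q) (σ P).O1) ∧
              Claim189 (new189 (D189OfRecord θ.toStage9Params P (σ P))) (chiPP (D189OfRecord θ.toStage9Params P (σ P)))) :
    S_N12 Rec :=
  s_N12_of_refines₁₁CB10YZW_of_displays Rec href (fun F D w hR θ hP Mstar ops ζ lamW hθ hD hup P => by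
    obtain ⟨lam₀, σ, hl, h⟩ := hyp F D w hR θ hP Mstar ops ζ lamW hθ hD hup
    obtain ⟨hk, hmass, hP1, h180, h189⟩ := h P
    rw [hl, B15Claim189PinAtRecord.pinD189_pinRPrime_comm]
    exact wDisplays₁₀_pinD189_of_rPrimePin hP.base σ hk rfl hmass hP1 h180 h189)

end PinnedLayers

/-! ## §4 (v1.2) DEGENERATE-RUN FORMS — the closers of §2–§3 with the `kSel P < P.K` clause REPAIRED (A2 self-report of this seat: `B12.RunParams` has no `1 ≤ K` law,
so that clause is unsatisfiable at `K = 0` runs and §2–§3, as ∀-run hypotheses, are vacuous over a record predicate; here the clause is «`P.K ≤ kSel P →` the knit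
datum's support provisos are displayed», void below `K` — the n12-e seat's `B15RPrime1100AtRecord` v1.2 `wDisplays₁₀_of_rPrimePin_deg`) -/

section Degenerate

open Literature.MathematicalPhysics.QuantumFieldTheory.Balaban1983to89.B15RPrime1100AtRecord (wDisplays₁₀_of_rPrimePin_deg)
open Literature.MathematicalPhysics.QuantumFieldTheory.Balaban1983to89.B15Claim189PinAtRecord (D189OfRecord)
open Literature.MathematicalPhysics.QuantumFieldTheory.Balaban1983to89.Node00 (Sit189)

/-- **`S_N12 Rec` FOR EVERY `Rec ⊆ ₁₁CB10YZW`, (1.100) DATA PINNED, DEGENERATE-RUN FORM** (v1.2): per `Rec`-pair, presenting package and run — the degenerate-run clause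
`P.K ≤ kSel P → ProvisosSupp` (void below `K`, where the record's `rstep` serves), the pin equation on the hidden layer's `D1100`, positive mass, [IV] Proposition 1 (1.78),
(1.80), (1.89) ⇒ `S_N12 Rec`.  Hypotheses satisfiable on `B12.RunParams` as typed. [cite: Balaban1989LargeFieldI, Prop. 1 (1.78) p.194, (0.2)–(0.6) p.176, (1.80) p.195, (1.89) p.198, (1.99)–(1.102) pp.200–201] -/
theorem s_N12_of_refines₁₁CB10YZW_of_rPrimePin_deg (Rec : RecordPred N)
    (href : ∀ (F : T4Family) (D : Datum F N) (w : WorldP), Rec F D w → IsRecordOfRecord₁₁CB10YZW F N D w)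
    (hyp : ∀ (F : T4Family) (D : Datum F N) (w : WorldP), Rec F D w →
      ∀ (θ : Stage11Params F N) (hP : θ.Provisos₁₁) (Mstar : ℕ) (ops : OpsY N θ.toStage3Params Mstar) (ζ : ResidZ F N) (lamW : ResidW F N),
        θ.Admissible → D = datumOfRecord₁₁ F N θ hP → (∀ P, w.up P = upOfRecord₅C F N (θ.view₁₁B10YZW F N Mstar ops ζ lamW) P) → ∀ P : B12.RunParams,
          (P.K ≤ lamW.kSel P →
            (repDataOfSel (repTOfRecord9 F N θ.ν θ.τ9 (EOfRecord₁₀ F N θ.toStage9Params) (wOfRecord₉ F N θ.toStage9Params) θ.ppSel P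
                (gOfRecord₁₀ F N θ.toStage9Params P) (lamW.kSel P))
              (θ.ppSel P (gOfRecord₁₀ F N θ.toStage9Params P) (lamW.kSel P + 1))
              (fibOfSeq F θ.ν θ.τ9 P (gOfRecord₁₀ F N θ.toStage9Params P) (lamW.kSel P + 1))).ProvisosSupp) ∧
          lamW.D1100 P
            = rPrimeDataOfSel (repTOfRecord9 F N θ.ν θ.τ9 (EOfRecord₁₀ F N θ.toStage9Params) (wOfRecord₉ F N θ.toStage9Params) θ.ppSel P
                  (gOfRecord₁₀ F N θ.toStage9Params P) (lamW.kSel P))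
                (θ.ppSel P (gOfRecord₁₀ F N θ.toStage9Params P) (lamW.kSel P + 1))
                (fibOfSeq F θ.ν θ.τ9 P (gOfRecord₁₀ F N θ.toStage9Params P) (lamW.kSel P + 1)) ∧
          (∀ s, 0 < ∫ V, rterm (repTOfRecord9 F N θ.ν θ.τ9 (EOfRecord₁₀ F N θ.toStage9Params) (wOfRecord₉ F N θ.toStage9Params) θ.ppSel P
            (gOfRecord₁₀ F N θ.toStage9Params P) (lamW.kSel P)) s V ∂(fieldMeasure (F.P P.K) (lamW.kSel P + 1) (SU N))) ∧
          Prop1Printed (lamW.LF P) ∧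
          (∀ U, new189 (lamW.D189 P) U → ∀ i, (lamW.D189 P).h ≤ i → i ≤ (lamW.D189 P).k → ∀ q ∈ plaqsOf (dom (lamW.D189 P) i),
            Ineq180 ((lamW.D189 P).dev0 U q) ((lamW.D189 P).ε (lamW.D189 P).k) (lamW.D189 P).η (lamW.D189 P).B₃ (lamW.D189 P).B₅ (lamW.D189 P).M
              (lamW.D189 P).δ ((lamW.D189 P).dist q) (lamW.D189 P).O1) ∧
          Claim189 (new189 (lamW.D189 P)) (chiPP (lamW.D189 P))) :
    S_N12 Rec :=
  s_N12_of_refines₁₁CB10YZW_of_displays Rec href (fun F D w hR θ hP Mstar ops ζ lamW hθ hD hup P => by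
    obtain ⟨hdeg, hpin, hmass, hP1, h180, h189⟩ := hyp F D w hR θ hP Mstar ops ζ lamW hθ hD hup P
    exact wDisplays₁₀_of_rPrimePin_deg hP.base hdeg hpin hmass hP1 h180 h189)

/-- **The same at the five-pin record predicate `…₁₁CB10YZWB8`, DEGENERATE-RUN FORM** (v1.2). [cite: Balaban1989LargeFieldI, Prop. 1 (1.78) p.194, (0.2)–(0.6) p.176, (1.80) p.195, (1.89) p.198, (1.99)–(1.102) pp.200–201] -/
theorem s_N12_of_refines₁₁CB10YZWB8_of_rPrimePin_deg (Rec : RecordPred N)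
    (href : ∀ (F : T4Family) (D : Datum F N) (w : WorldP), Rec F D w → IsRecordOfRecord₁₁CB10YZWB8 F N D w)
    (hyp : ∀ (F : T4Family) (D : Datum F N) (w : WorldP), Rec F D w →
      ∀ (θ : Stage11Params F N) (hP : θ.Provisos₁₁) (lam : ResidB8 θ.toStage3Params) (Mstar : ℕ) (ops : OpsY N θ.toStage3Params Mstar) (ζ : ResidZ F N)
        (lamW : ResidW F N), θ.Admissible → D = datumOfRecord₁₁ F N θ hP →
          (∀ P, w.up P = upOfRecord₅CS F N (θ.view₁₁B8B10YZW F N lam Mstar ops ζ lamW) P) → ∀ P : B12.RunParams,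
          (P.K ≤ lamW.kSel P →
            (repDataOfSel (repTOfRecord9 F N θ.ν θ.τ9 (EOfRecord₁₀ F N θ.toStage9Params) (wOfRecord₉ F N θ.toStage9Params) θ.ppSel P
                (gOfRecord₁₀ F N θ.toStage9Params P) (lamW.kSel P))
              (θ.ppSel P (gOfRecord₁₀ F N θ.toStage9Params P) (lamW.kSel P + 1))
              (fibOfSeq F θ.ν θ.τ9 P (gOfRecord₁₀ F N θ.toStage9Params P) (lamW.kSel P + 1))).ProvisosSupp) ∧
          lamW.D1100 P
            = rPrimeDataOfSel (repTOfRecord9 F N θ.ν θ.τ9 (EOfRecord₁₀ F N θ.toStage9Params) (wOfRecord₉ F N θ.toStage9Params) θ.ppSel P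
                  (gOfRecord₁₀ F N θ.toStage9Params P) (lamW.kSel P))
                (θ.ppSel P (gOfRecord₁₀ F N θ.toStage9Params P) (lamW.kSel P + 1))
                (fibOfSeq F θ.ν θ.τ9 P (gOfRecord₁₀ F N θ.toStage9Params P) (lamW.kSel P + 1)) ∧
          (∀ s, 0 < ∫ V, rterm (repTOfRecord9 F N θ.ν θ.τ9 (EOfRecord₁₀ F N θ.toStage9Params) (wOfRecord₉ F N θ.toStage9Params) θ.ppSel P
            (gOfRecord₁₀ F N θ.toStage9Params P) (lamW.kSel P)) s V ∂(fieldMeasure (F.P P.K) (lamW.kSel P + 1) (SU N))) ∧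
          Prop1Printed (lamW.LF P) ∧
          (∀ U, new189 (lamW.D189 P) U → ∀ i, (lamW.D189 P).h ≤ i → i ≤ (lamW.D189 P).k → ∀ q ∈ plaqsOf (dom (lamW.D189 P) i),
            Ineq180 ((lamW.D189 P).dev0 U q) ((lamW.D189 P).ε (lamW.D189 P).k) (lamW.D189 P).η (lamW.D189 P).B₃ (lamW.D189 P).B₅ (lamW.D189 P).M
              (lamW.D189 P).δ ((lamW.D189 P).dist q) (lamW.D189 P).O1) ∧
          Claim189 (new189 (lamW.D189 P)) (chiPP (lamW.D189 P))) :
    S_N12 Rec :=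
  s_N12_of_refines₁₁CB10YZWB8_of_displays Rec href (fun F D w hR θ hP lam Mstar ops ζ lamW hθ hD hup P => by
    obtain ⟨hdeg, hpin, hmass, hP1, h180, h189⟩ := hyp F D w hR θ hP lam Mstar ops ζ lamW hθ hD hup P
    exact wDisplays₁₀_of_rPrimePin_deg hP.base hdeg hpin hmass hP1 h180 h189)

/-- **`S_N12 Rec` AT DOUBLY PINNED LAYERS, DEGENERATE-RUN FORM** (v1.2, the repaired `s_N12_of_refines₁₁CB10YZW_of_pinnedLayers`): the hidden [IV] layer IS
`(λ₀.pinD189 θ σ).pinRPrime θ`; per run the degenerate-run clause (void below `K`), positive mass, Proposition 1 (1.78) on `λ₀.LF P`, (1.80) at `σ.dev0`, (1.89) at the PINNED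
letters `D189OfRecord θ P (σ P)` ⇒ `S_N12 Rec`. [cite: Balaban1989LargeFieldI, Prop. 1 (1.78) p.194, (0.2)–(0.6) p.176, (1.80) p.195, (1.89) p.198, (1.99)–(1.102) pp.200–201] -/
theorem s_N12_of_refines₁₁CB10YZW_of_pinnedLayers_deg (Rec : RecordPred N)
    (href : ∀ (F : T4Family) (D : Datum F N) (w : WorldP), Rec F D w → IsRecordOfRecord₁₁CB10YZW F N D w)
    (hyp : ∀ (F : T4Family) (D : Datum F N) (w : WorldP), Rec F D w →
      ∀ (θ : Stage11Params F N) (hP : θ.Provisos₁₁) (Mstar : ℕ) (ops : OpsY N θ.toStage3Params Mstar) (ζ : ResidZ F N) (lamW : ResidW F N),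
        θ.Admissible → D = datumOfRecord₁₁ F N θ hP → (∀ P, w.up P = upOfRecord₅C F N (θ.view₁₁B10YZW F N Mstar ops ζ lamW) P) →
          ∃ (lam₀ : ResidW F N) (σ : ∀ P : B12.RunParams, Sit189 F N P.K),
            lamW = (lam₀.pinD189 θ.toStage9Params σ).pinRPrime θ.toStage9Params ∧ ∀ P : B12.RunParams,
              (P.K ≤ lam₀.kSel P →
                (repDataOfSel (repTOfRecord9 F N θ.ν θ.τ9 (EOfRecord₁₀ F N θ.toStage9Params) (wOfRecord₉ F N θ.toStage9Params) θ.ppSel P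
                    (gOfRecord₁₀ F N θ.toStage9Params P) (lam₀.kSel P))
                  (θ.ppSel P (gOfRecord₁₀ F N θ.toStage9Params P) (lam₀.kSel P + 1))
                  (fibOfSeq F θ.ν θ.τ9 P (gOfRecord₁₀ F N θ.toStage9Params P) (lam₀.kSel P + 1))).ProvisosSupp) ∧
              (∀ s, 0 < ∫ V, rterm (repTOfRecord9 F N θ.ν θ.τ9 (EOfRecord₁₀ F N θ.toStage9Params) (wOfRecord₉ F N θ.toStage9Params) θ.ppSel P
                (gOfRecord₁₀ F N θ.toStage9Params P) (lam₀.kSel P)) s V ∂(fieldMeasure (F.P P.K) (lam₀.kSel P + 1) (SU N))) ∧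
              Prop1Printed (lam₀.LF P) ∧
              (∀ U, new189 (D189OfRecord θ.toStage9Params P (σ P)) U → ∀ i, (σ P).h ≤ i → i ≤ (σ P).k →
                ∀ q ∈ plaqsOf (dom (D189OfRecord θ.toStage9Params P (σ P)) i),
                  Ineq180 ((σ P).dev0 U.1 q) (epsOfRecord θ.ν (gOfRecord₁₀ F N θ.toStage9Params P) (σ P).k) ((F.P P.K).eta (σ P).k) (σ P).B₃ (σ P).B₅ (σ P).M
                    (σ P).δ ((σ P).dist q) (σ P).O1) ∧
              Claim189 (new189 (D189OfRecord θ.toStage9Params P (σ P))) (chiPP (D189OfRecord θ.toStage9Params P (σ P)))) :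
    S_N12 Rec :=
  s_N12_of_refines₁₁CB10YZW_of_displays Rec href (fun F D w hR θ hP Mstar ops ζ lamW hθ hD hup P => by
    obtain ⟨lam₀, σ, hl, h⟩ := hyp F D w hR θ hP Mstar ops ζ lamW hθ hD hup
    obtain ⟨hdeg, hmass, hP1, h180, h189⟩ := h P
    rw [hl, B15Claim189PinAtRecord.pinD189_pinRPrime_comm]
    exact wDisplays₁₀_of_rPrimePin_deg (lam := (lam₀.pinRPrime θ.toStage9Params).pinD189 θ.toStage9Params σ) hP.base hdeg rfl hmass hP1 h180 h189)

end Degenerate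

end Summit.QuantumFields.YangMills.BalabanUVNodes.N12RPrimePin

end
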